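import Mathlib
import Summits.Ventures.HodgeRepro.Tier4.Common.AdelicDefs
import Summits.Ventures.HodgeRepro.Tier4.Line1.RowBasis

/-!
# Tier4/Line1/RationalConjScalar — LINE L1, (iii′) `exists_rational_conj`, part 1: the scalar by which an adelic
torus element acts on the line `W₀`, its norm, and the central unitary `S = x·1 − y·Ω`

Blind re-derivation cell `pub-hodge-repro`, Tier 4 «prove the step» (README §9–§10), seat t4-L1-p2 (prover, gen 0),
LINE L1, assignment S12586 (plan-1 g1): (iii′) the core of J2.b.  This module (row convention of typer-2's
`unitaryGroup`): H1 `exists_row_scalar_action` — an adelic matrix commuting with `P₀` acts on the rational row line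
`W₀` (basis `w, wΩ` with `w P₀ = w`, a complement `w₁` with `w₁ P₀ = 0`) as an `E′_𝔸`-scalar `x + yΩ`;
`form_vecMul_unitary` — `T B Tᵀ = B` preserves the adelic form `u B vᵀ`; H2 `norm_eq_one_of_unitary` — for a unitary
`T` the scalar has norm `x² + d y² = 1` (the form of the rational `w` is a non-zero rational number, hence a unit of
`𝔸_k`); `scalar_comm`, `adMat_Omega_mul_self`, `adMat_neg`, `adMat_Omega_mul_B`, `scalar_mul_B_mul_transpose` —
`S = x·1 − y·Ω` with `x² + d y² = 1` is a unitary (`S B Sᵀ = B`) commuting with everything that commutes with `Ω`;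
H5 `mem_rationalPoints_of_mat` — an element of `U(W)(𝔸_k)` whose matrix is the image of a rational matrix is a
rational point (its determinant is a non-zero rational number).

Nothing here says anything about the status of the Hodge conjecture for CM abelian varieties, which is NOT proved
(HC_CM is NOT proved by anyone in this repository).
-/

set_option autoImplicit false

noncomputable section

namespace Summit.Ventures.HodgeRepro.Tier4.Line1

open Matrix NumberField Summit.Ventures.HodgeRepro.Tier4.Common



section Conj

variable {k : Type} [Field k] [NumberField k] (W : PlaneData k)

/-- H1 (row scalar action): an adelic matrix `T` commuting with `Ω` and `P₀` acts on the row line `W₀` as an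
`E′_𝔸`-scalar: `w T = x w + y wΩ` for the rational `w` of the row basis. -/
theorem exists_row_scalar_action {d : k} (hΩ : W.Ω * W.Ω = -(d • (1 : Matrix (Fin 4) (Fin 4) k)))
    (hd : ¬ IsSquare (-d)) {w w₁ : Fin 4 → k} (h0 : w ≠ 0) (h1 : w₁ ≠ 0)
    (hP0 : w ᵥ* W.P 0 = w) (hP1 : w₁ ᵥ* W.P 0 = 0) {T : M4 k}
    (hTP : T * adMat k (W.P 0) = adMat k (W.P 0) * T) :
    ∃ x y : Ad k, (algebraMap k (Ad k) ∘ w) ᵥ* T =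
      x • (algebraMap k (Ad k) ∘ w) + y • (algebraMap k (Ad k) ∘ (w ᵥ* W.Ω)) := by
  have hdet := det_rowMat_ne_zero W hΩ hd h0 h1 hP0 hP1
  obtain ⟨c, hc⟩ := exists_vecMul_eq hdet ((algebraMap k (Ad k) ∘ w) ᵥ* T)
  have hPΩ : ∀ x : Fin 4 → k, (x ᵥ* W.Ω) ᵥ* W.P 0 = (x ᵥ* W.P 0) ᵥ* W.Ω := by
    intro x
    rw [Matrix.vecMul_vecMul, Matrix.vecMul_vecMul, W.P_comm 0]
  -- `P₀` on a coordinate expansion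
  have hP0E : ∀ c : Fin 4 → Ad k,
      (c ᵥ* adMat k (Matrix.of fun i j => (![w, w ᵥ* W.Ω, w₁, w₁ ᵥ* W.Ω] i) j)) ᵥ* adMat k (W.P 0) =
        ![c 0, c 1, 0, 0] ᵥ* adMat k (Matrix.of fun i j => (![w, w ᵥ* W.Ω, w₁, w₁ ᵥ* W.Ω] i) j) := by
    intro c
    rw [vecMul_adMat_rowMat, vecMul_adMat_rowMat]
    simp only [Matrix.add_vecMul, Matrix.smul_vecMul, vecMul_adMat_algebraMap_comp, hP0, hPΩ, hP1,
      Matrix.zero_vecMul, Matrix.cons_val_zero, Matrix.cons_val_one, Matrix.cons_val_two,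
      Matrix.cons_val_three, Matrix.head_cons, Matrix.tail_cons, zero_smul, add_zero]
    have h0' : (algebraMap k (Ad k)) ∘ (0 : Fin 4 → k) = 0 := by funext i; simp
    rw [h0', smul_zero, smul_zero, add_zero, add_zero]
  -- `P₀` fixes `w T`
  have hfix : ((algebraMap k (Ad k) ∘ w) ᵥ* T) ᵥ* adMat k (W.P 0) = (algebraMap k (Ad k) ∘ w) ᵥ* T := by
    rw [Matrix.vecMul_vecMul, hTP, ← Matrix.vecMul_vecMul, vecMul_adMat_algebraMap_comp, hP0]
  have hc' : c = ![c 0, c 1, 0, 0] := by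
    apply vecMul_injective_of_det_ne_zero hdet
    rw [← hP0E, hc, hfix]
  have hc2 : c 2 = 0 := by
    have := congrFun hc' 2
    simpa using this
  have hc3 : c 3 = 0 := by
    have := congrFun hc' 3
    simpa using this
  refine ⟨c 0, c 1, ?_⟩
  rw [← hc, vecMul_adMat_rowMat, hc2, hc3, zero_smul, zero_smul, add_zero, add_zero]

/-- unitarity `T B Tᵀ = B` preserves the adelic row form -/
theorem form_vecMul_unitary {T : M4 k} (hT : T * adMat k W.B * T.transpose = adMat k W.B)
    (u v : Fin 4 → Ad k) : (u ᵥ* T) ᵥ* adMat k W.B ⬝ᵥ (v ᵥ* T) = u ᵥ* adMat k W.B ⬝ᵥ v := by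
  rw [Matrix.vecMul_vecMul, ← Matrix.mulVec_transpose T v, Matrix.dotProduct_mulVec, Matrix.vecMul_vecMul,
    hT]

/-- H2 (the norm): the `E′_𝔸`-scalar `x + yΩ` by which a unitary `T` acts on `W₀` has norm `x² + d y² = 1`
(unitarity on the rational `w` with `β(w, w) ≠ 0`). -/
theorem norm_eq_one_of_unitary {d : k} (hΩ : W.Ω * W.Ω = -(d • (1 : Matrix (Fin 4) (Fin 4) k)))
    (hΩB : W.Ω * W.B = -(W.B * W.Ω.transpose)) {w : Fin 4 → k} (hβ : w ᵥ* W.B ⬝ᵥ w ≠ 0) {T : M4 k}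
    (hT : T * adMat k W.B * T.transpose = adMat k W.B) {x y : Ad k}
    (hxy : (algebraMap k (Ad k) ∘ w) ᵥ* T =
      x • (algebraMap k (Ad k) ∘ w) + y • (algebraMap k (Ad k) ∘ (w ᵥ* W.Ω))) :
    x * x + algebraMap k (Ad k) d * (y * y) = 1 := by
  have h1 := form_vecMul_unitary W hT (algebraMap k (Ad k) ∘ w) (algebraMap k (Ad k) ∘ w)
  rw [hxy] at h1
  -- expand the left-hand side
  have hexp : (x • (algebraMap k (Ad k) ∘ w) + y • (algebraMap k (Ad k) ∘ (w ᵥ* W.Ω))) ᵥ* adMat k W.B ⬝ᵥ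
      (x • (algebraMap k (Ad k) ∘ w) + y • (algebraMap k (Ad k) ∘ (w ᵥ* W.Ω))) =
      (x * x + algebraMap k (Ad k) d * (y * y)) * algebraMap k (Ad k) (w ᵥ* W.B ⬝ᵥ w) := by
    simp only [Matrix.add_vecMul, Matrix.smul_vecMul, add_dotProduct, dotProduct_add, smul_dotProduct,
      dotProduct_smul, smul_eq_mul, form_algebraMap_comp]
    rw [form_vecMul_Omega_left W hΩB w w, form_vecMul_Omega_self W hΩ hΩB w]
    simp only [map_neg, map_mul]
    ring
  rw [hexp, form_algebraMap_comp] at h1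
  have hunit : IsUnit (algebraMap k (Ad k) (w ᵥ* W.B ⬝ᵥ w)) :=
    (isUnit_iff_ne_zero.2 hβ).map (algebraMap k (Ad k))
  rcases hunit with ⟨u, hu⟩
  rw [← hu] at h1
  have h2 : (x * x + algebraMap k (Ad k) d * (y * y) - 1) * (u : Ad k) = 0 := by
    rw [sub_mul, one_mul, h1, sub_self]
  have h3 := (Units.mul_left_eq_zero u).1 h2
  exact sub_eq_zero.1 h3

end Conj


/-! ### the central unitary `S = x·1 − y·Ω` and rationality from the matrix -/

section Conj2

variable {k : Type} [Field k] [NumberField k] (W : PlaneData k)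

/-- an adelic `E′`-scalar `x·1 + y·Ω` commutes with every matrix commuting with `Ω` -/
theorem scalar_comm {M : M4 k} (hM : M * adMat k W.Ω = adMat k W.Ω * M) (x y : Ad k) :
    M * (x • (1 : M4 k) + y • adMat k W.Ω) = (x • (1 : M4 k) + y • adMat k W.Ω) * M := by
  rw [Matrix.mul_add, Matrix.add_mul, Matrix.mul_smul, Matrix.smul_mul, Matrix.mul_smul, Matrix.smul_mul,
    Matrix.mul_one, Matrix.one_mul, hM]

/-- `adMat Ω · adMat Ω = −(φ d)·1` -/
theorem adMat_Omega_mul_self {d : k} (hΩ : W.Ω * W.Ω = -(d • (1 : Matrix (Fin 4) (Fin 4) k))) :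
    adMat k W.Ω * adMat k W.Ω = -(algebraMap k (Ad k) d • (1 : M4 k)) := by
  rw [← adMat_mul, hΩ]
  ext i j
  simp only [adMat, Matrix.map_apply, Matrix.neg_apply, Matrix.smul_apply, Matrix.one_apply, smul_eq_mul,
    map_neg, map_mul]
  split_ifs <;> simp

/-- `adMat (−A) = −adMat A` -/
theorem adMat_neg (A : Matrix (Fin 4) (Fin 4) k) : adMat k (-A) = -adMat k A := by
  ext i j
  simp only [adMat, Matrix.map_apply, Matrix.neg_apply, map_neg]

/-- `adMat Ω · adMat B = −(adMat B · (adMat Ω)ᵀ)` -/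
theorem adMat_Omega_mul_B (hΩB : W.Ω * W.B = -(W.B * W.Ω.transpose)) :
    adMat k W.Ω * adMat k W.B = -(adMat k W.B * (adMat k W.Ω).transpose) := by
  rw [← adMat_mul, hΩB, ← adMat_transpose, ← adMat_mul, adMat_neg]

/-- the `E′`-scalar `S = x·1 − y·Ω` of norm `x² + d y² = 1` is a unitary: `S B Sᵀ = B` -/
theorem scalar_mul_B_mul_transpose {d : k} (hΩ : W.Ω * W.Ω = -(d • (1 : Matrix (Fin 4) (Fin 4) k)))
    (hΩB : W.Ω * W.B = -(W.B * W.Ω.transpose)) {x y : Ad k}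
    (hn : x * x + algebraMap k (Ad k) d * (y * y) = 1) :
    (x • (1 : M4 k) - y • adMat k W.Ω) * adMat k W.B * (x • (1 : M4 k) - y • adMat k W.Ω).transpose =
      adMat k W.B := by
  have hΩB' := adMat_Omega_mul_B W hΩB
  have hΩΩ := adMat_Omega_mul_self W hΩ
  have hΩBΩ : adMat k W.Ω * adMat k W.B * (adMat k W.Ω).transpose =
      algebraMap k (Ad k) d • adMat k W.B := by
    rw [hΩB', Matrix.neg_mul, Matrix.mul_assoc, ← Matrix.transpose_mul, hΩΩ, Matrix.transpose_neg,
      Matrix.transpose_smul, Matrix.transpose_one, Matrix.mul_neg, neg_neg, Matrix.mul_smul, Matrix.mul_one]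
  rw [Matrix.transpose_sub, Matrix.transpose_smul, Matrix.transpose_smul, Matrix.transpose_one]
  simp only [Matrix.sub_mul, Matrix.mul_sub, Matrix.smul_mul, Matrix.mul_smul, Matrix.one_mul,
    Matrix.mul_one]
  rw [Matrix.mul_assoc (adMat k W.Ω) (adMat k W.B), ← Matrix.mul_assoc (adMat k W.Ω) (adMat k W.B), hΩBΩ,
    hΩB']
  -- `x x B − x y (B Ωᵀ) − (y x (−(B Ωᵀ)) − y y (φ d • B)) = B`
  trans (x * x + algebraMap k (Ad k) d * (y * y)) • adMat k W.B
  · module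
  · rw [hn, one_smul]

/-- H5: an element of `U(W)(𝔸_k)` whose matrix is the image of a rational matrix is a rational point -/
theorem mem_rationalPoints_of_mat (g : GA W) {A : Matrix (Fin 4) (Fin 4) k} (h : GA.mat W g = adMat k A) :
    g ∈ rationalPoints W := by
  have hdet : A.det ≠ 0 := by
    intro h0
    have hu : IsUnit (GA.mat W g).det :=
      (Matrix.isUnit_iff_isUnit_det _).1 ((g : GL4 k).isUnit)
    rw [h] at hu
    have : (adMat k A).det = algebraMap k (Ad k) A.det := by
      rw [RingHom.map_det, RingHom.mapMatrix_apply]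
      rfl
    rw [this, h0, map_zero] at hu
    haveI : Nontrivial (Ad k) := (NumberField.AdeleRing.algebraMap_injective (𝓞 k) k).nontrivial
    exact not_isUnit_zero hu
  rw [rationalPoints, Subgroup.mem_subgroupOf, principalGL, MonoidHom.mem_range]
  refine ⟨Matrix.GeneralLinearGroup.mkOfDetNeZero A hdet, ?_⟩
  apply Units.ext
  change (Matrix.GeneralLinearGroup.mkOfDetNeZero A hdet : Matrix (Fin 4) (Fin 4) k).map
    (algebraMap k (Ad k)) = GA.mat W g
  rw [h]
  rfl

end Conj2

end Summit.Ventures.HodgeRepro.Tier4.Line1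

end
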